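/- Copyright: the b2b-balaban cell (near-miss cell 7), T⁴-continuum fan-out, ROUND-2 swarm `t4-ne7b-formalise-*`
(leaf 08), row NE7b (node U5c COUNT member).  Released under the licence of the surrounding project. -/
import Literature.MathematicalPhysics.QuantumFieldTheory.Balaban1983to89.B16MergeHorizon
import Literature.MathematicalPhysics.QuantumFieldTheory.Balaban1983to89.T4PersistenceDictionary

/-!
# History windows: the three physical lifetime bounds of the index model versus the dictionary's booked windows
(swarm row S1b «H1b geometric layer», part 1 of 2)

Summits-side support leaf of the T⁴-continuum cell (rung (B)+1 on a FINITE torus only; NOT infinite volume, NOT the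
mass gap, NOT the Clay statement; NOT a proof of the spine estimate NE7b).  Row S1b of the swarm claim table
`t4/b2b-balaban-t4-ne7b-p1/LEAVES-NE7b.md` (v2.1; typer mirror `t4/formal/NE7b/LEAVES.md` row S1b, «critical path»).
[folklore] finite combinatorics in the ℤᵈ INDEX MODEL of the operation `S` (modules `…B16SProfile`,
`…B16StoppingRule`, `…B16MergeHorizon`, `…B16Absorption`, all [K]) joined to the READING (ID) of
`…T4PersistenceDictionary` (the window table `dictW`, `fatWait`).  Nothing printed is asserted: B16 =
[Balaban1989LargeFieldII] §1 pp. 384–387 is the thing under audit; its three lifetime sentences («K ≤ n₀ − j + R_j»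
p. 385, «hence K = R_{j+1} for Z» p. 386, «K ≤ K₂ + n₁ + R_{j+1}» p. 387) are what the dictionary BOOKED as windows,
and what this file PROVES in the index model.  No `[cite:]` tag; no `def … : Prop` fact of print (trigger c1): the
two `def`s below (`Boxed`, nothing else) are parametrised predicates of the model.

WHY.  The sockets of the count route (`HistorySocket*.LiveHistories*`) display, per live structure, `pending :
K < G.reach (dictW (R K) C.n₁)` — «physically pending at the cutoff ⇒ inside the BOOKED life».  Row S1 (`HistoryAdmissible`,
p207789) types the skeleton `PGen` and DISPLAYS the timing (`Adm`, `JoinInLife`); row S1b (this part + `HistoryRealise`)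
DERIVES it from the geometry: a region without events is ready no later than `fatWait d′ + R_j` steps after its birth
(§3), a renewed component `R_{h+1}` steps after its renewal (§4), a merged one `13 + R_s` steps after the later
partner's own readiness (§5) — each STRICTLY INSIDE the booked window `dictW` (§6), provided the merger allowance of the
model constants is `n₁ ≥ 13` (the tree's absorption constant, `B16MergeHorizon.find_stopAt_merge_le'`).

WHAT.  §1 boxed sets and one `S`-step on a box (width `w ↦ ⌈w∕q⌉ + 20`).  §2 **`condI_from_add_two`**: if an iterate
sequence satisfies condition (i) (`CondI 100`) at index `K`, it satisfies it at EVERY index `≥ K + 2` on the horizon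
(`L ≥ 3`, drop control: the one possibly bad scale is `K + 1` after a no-gain step, `99 + 20 = 119`; the next step gains,
`⌈119∕3⌉ + 20 = 60`, and from then on the width stays `≤ 80`).  §3 **`threshold_le_fatWait`** (the last fat index
`i₀ ≤ fatWait d′` for a region of class `d′ ≥ treeLen`, from `B16SProfile.two_pow_mul_treeLen_closureIdx_le`, `L ≥ 4`) and
**`stopAt_birth`** («K ≤ n₀ − j + R_j»: the stopping property at some `k ≤ fatWait d′ + N`).  §4 **`stopAt_restart`**
(«K = R_{j+1}»: after a stop at `K` and a renewal at `K + 1`, the stopping property with memory `N′` holds at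
`K + 1 + N′`).  §5 **`stopAt_join`** («K ≤ K₂ + n₁ + R_{j+1}», symmetric wrapper of `B16MergeHorizon.stopAt_merge`: partners
touching at the join scale with condition (i) at own indices `K₁, K₂ ≥ 1` ⇒ the union stops at some
`k ≤ max K₁ K₂ + 13 + N`).  §6 the three bounds against `dictW`: `birth_lt_dictW`, `restart_lt_dictW`, `join_lt_dictW`.

HONEST.  Index-model geometry + arithmetic; the identification of the model's cells with print's `M R_j`-cubes and of
`Clean` with «no new large fields» is the reading (ID) (owner's ruling R-OWNER-22-2: one cell ≡ one `M R_j`-cube, scales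
indexed by the model scale, ratio `L^{δ}` per step); NE7b NOT proved; spine 0∕9.  HONEST DEPENDENCY (cell): continuum YM
on T⁴ ⇐ BetaPertH ∧ nine spine estimates (0/9 proved); BetaPertH ⇐ (D1) ∧ (D4) ∧ CAP+tail; G-an2-4 gates asym, D1 and
NE2/3/4.  This file changes none of it. -/

open Finset
open Literature.MathematicalPhysics.QuantumFieldTheory.Balaban1983to89
open Literature.MathematicalPhysics.QuantumFieldTheory.Balaban1983to89.B13ScaleTransfer
open Literature.MathematicalPhysics.QuantumFieldTheory.Balaban1983to89.TreeLength
open Literature.MathematicalPhysics.QuantumFieldTheory.Balaban1983to89.B16SProfile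
open Literature.MathematicalPhysics.QuantumFieldTheory.Balaban1983to89.B16StoppingRule
open Literature.MathematicalPhysics.QuantumFieldTheory.Balaban1983to89.B16MergeGeometry
open Literature.MathematicalPhysics.QuantumFieldTheory.Balaban1983to89.B16Absorption
open Literature.MathematicalPhysics.QuantumFieldTheory.Balaban1983to89.B16MergeHorizon
open T4PersistenceDictionary

namespace Summit.QuantumFields.BalabanUV.T4Continuum.HistoryWindows

variable {d : ℕ}

/-! ## §1 Boxed sets and one `S`-step on a box -/

/-- `X` lies in a product box of width `≤ w` in every coordinate (`w = side − 1`). [folklore] -/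
def Boxed (w : ℤ) : Finset (Pt d) → Prop := fun X => ∃ lo hi : Pt d, X ⊆ pbox lo hi ∧ ∀ i, hi i - lo i ≤ w

/-- wider boxes [folklore] -/
theorem Boxed.mono {w w' : ℤ} (h : w ≤ w') {X : Finset (Pt d)} (hX : Boxed w X) : Boxed w' X := by
  obtain ⟨lo, hi, hX, hw⟩ := hX
  exact ⟨lo, hi, hX, fun i => (hw i).trans h⟩

/-- condition (i) with `100` cubes per side is `Boxed 99` [folklore] -/
theorem boxed_of_condI {X : Finset (Pt d)} (h : CondI 100 X) : Boxed 99 X := by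
  obtain ⟨lo, hi, hX, hhi⟩ := exists_pbox_of_fitsIn h
  exact ⟨lo, hi, hX, fun i => by rw [hhi i]; push_cast; omega⟩

/-- … and conversely [folklore] -/
theorem condI_of_boxed {X : Finset (Pt d)} (h : Boxed 99 X) : CondI 100 X := by
  obtain ⟨lo, hi, hX, hw⟩ := h
  exact fitsIn_of_subset_pbox hX fun i => by have := hw i; omega

/-- **ONE `S`-STEP ON A BOXED SET**: `S_q` maps a set boxed with width `w` into a box of width `≤ ⌈w∕q⌉ + 20` (cover,
then ten layers on each side; `B16Absorption.Sop_pbox_subset`). [folklore] -/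
theorem Boxed.sop {q : ℕ} (hq : 0 < q) {w : ℤ} {X : Finset (Pt d)} (hX : Boxed w X) :
    Boxed (cdiv w q + 20) (Sop q X) := by
  obtain ⟨lo, hi, hX, hw⟩ := hX
  refine ⟨fun i => lo i / (q : ℤ) - 10, fun i => hi i / (q : ℤ) + 10,
    (Sop_mono q hX).trans (Sop_pbox_subset hq lo hi), fun i => ?_⟩
  have h := ediv_le_ediv_add_cdiv hq (show hi i ≤ lo i + w by have := hw i; omega)
  simp only
  omega

/-- a no-gain step (`q = 1`) widens by `20` [folklore] -/
theorem Boxed.sop_one {w : ℤ} {X : Finset (Pt d)} (hX : Boxed w X) : Boxed (w + 20) (Sop 1 X) := by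
  have h := hX.sop Nat.one_pos
  rwa [cdiv_one] at h

/-- a gaining step with ratio `q ≥ 3` contracts the width to `≤ ⌈w∕3⌉ + 20` (`w ≥ 0`) [folklore] -/
theorem Boxed.sop_three {q : ℕ} (hq : 3 ≤ q) {w : ℤ} (hw : 0 ≤ w) {X : Finset (Pt d)} (hX : Boxed w X) :
    Boxed (cdiv w 3 + 20) (Sop q X) := by
  have h := hX.sop (show 0 < q by omega)
  refine h.mono ?_
  have h0 : 0 ≤ cdiv w 3 := cdiv_nonneg (by norm_num) hw
  have h1 : w ≤ cdiv w 3 * (3 : ℕ) := le_cdiv_mul w (by norm_num)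
  have hq' : ((3 : ℕ) : ℤ) ≤ q := by exact_mod_cast hq
  have h2 : cdiv w q ≤ cdiv w 3 := cdiv_le_of_le_mul (by omega) (h1.trans (mul_le_mul_of_nonneg_left hq' h0))
  omega

/-- a gaining step of the flow has ratio `≥ L` (`ratio = L^{e}` with `e ≥ 1` as soon as `ratio ≥ 2`) [folklore] -/
theorem le_ratio_of_two_le {L : ℕ} {σ : ℕ → ℕ} {l : ℕ} (h : 2 ≤ ratio L σ l) : L ≤ ratio L σ l := by
  unfold ratio at h ⊢
  rcases Nat.eq_zero_or_pos (qexp σ l) with h0 | hpos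
  · rw [h0, pow_zero] at h; omega
  · exact Nat.le_self_pow hpos.ne' L

/-- a non-gaining step of the flow has ratio `1` (`L ≥ 2`) [folklore] -/
theorem ratio_eq_one_of_lt_two {L : ℕ} (hL : 2 ≤ L) {σ : ℕ → ℕ} {l : ℕ} (h : ¬ 2 ≤ ratio L σ l) :
    ratio L σ l = 1 := by
  unfold ratio at h ⊢
  rcases Nat.eq_zero_or_pos (qexp σ l) with h0 | hpos
  · rw [h0, pow_zero]
  · exfalso; exact h ((hL.trans (Nat.le_self_pow hpos.ne' L)))

/-! ## §2 Condition (i) persists from two scales after any scale where it holds -/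

/-- **PERSISTENCE OF CONDITION (i).**  Along an iterate sequence `X (l+1) = S_{q_l}(X l)` of the flow (`q = ratio L σ`,
`L ≥ 3`, drop control on the horizon `m`): if `X K` satisfies (i) (`100` cubes per side) then so does `X l` for EVERY
`K + 2 ≤ l ≤ m`.  (The scale `K + 1` may fail after a no-gain step: width `99 + 20`; the drop control forbids two
consecutive no-gain steps, the next step contracts to `⌈119∕3⌉ + 20 = 60`, and the width then stays `≤ 80`.)
[folklore] -/
theorem condI_from_add_two {L : ℕ} (hL : 3 ≤ L) {σ : ℕ → ℕ} {m : ℕ} (hσ : DropCtl σ m) {X : ℕ → Finset (Pt d)}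
    (hX : ∀ l, X (l + 1) = Sop (ratio L σ l) (X l)) {K : ℕ} (hK : CondI 100 (X K)) :
    ∀ l, K + 2 ≤ l → l ≤ m → CondI 100 (X l) := by
  have halt := altGain_ratio (show 2 ≤ L by omega) hσ
  -- invariant from `K + 1` on: width ≤ 60, or (last step did not gain ∧ width ≤ 80), or (l = K+1 ∧ width ≤ 119)
  have inv : ∀ t, K + 1 + t ≤ m →
      (Boxed 60 (X (K + 1 + t)) ∨ (¬ 2 ≤ ratio L σ (K + t) ∧ (Boxed 80 (X (K + 1 + t)) ∨
        (t = 0 ∧ Boxed 119 (X (K + 1 + t)))))) := by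
    intro t
    induction t with
    | zero =>
        intro _
        have hb := boxed_of_condI hK
        by_cases hg : 2 ≤ ratio L σ K
        · left
          have h := hb.sop_three ((hL.trans (le_ratio_of_two_le hg))) (by norm_num)
          rw [← hX] at h
          exact h.mono (by norm_num [cdiv])
        · right
          refine ⟨by simpa using hg, Or.inr ⟨rfl, ?_⟩⟩
          have hstep : X (K + 1) = Sop 1 (X K) := by rw [hX, ratio_eq_one_of_lt_two (by omega) hg]
          have h := hb.sop_one
          rw [← hstep] at h
          exact h.mono (by norm_num)
    | succ t ih =>
        intro ht
        have ih' := ih (by omega)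
        have hstep : X (K + 1 + (t + 1)) = Sop (ratio L σ (K + 1 + t)) (X (K + 1 + t)) := by
          rw [show K + 1 + (t + 1) = K + 1 + t + 1 by omega]; exact hX _
        by_cases hg : 2 ≤ ratio L σ (K + 1 + t)
        · -- a gaining step: from width ≤ 119 to ≤ 60
          left
          have hq3 : 3 ≤ ratio L σ (K + 1 + t) := hL.trans (le_ratio_of_two_le hg)
          have hb : Boxed 119 (X (K + 1 + t)) := by
            rcases ih' with h | ⟨-, h | ⟨-, h⟩⟩
            · exact h.mono (by norm_num)
            · exact h.mono (by norm_num)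
            · exact h
          have h := hb.sop_three hq3 (by norm_num)
          rw [← hstep] at h
          exact h.mono (by norm_num [cdiv])
        · -- a no-gain step: the previous step gained, so the width was ≤ 60 and becomes ≤ 80
          right
          refine ⟨by rw [show K + (t + 1) = K + 1 + t by omega]; exact hg, Or.inl ?_⟩
          have hprev : 2 ≤ ratio L σ (K + t) := by
            rcases halt (K + t) (by omega) with h | h
            · exact h
            · exfalso; rw [show K + t + 1 = K + 1 + t by omega] at h; exact hg h
          have hb : Boxed 60 (X (K + 1 + t)) := by
            rcases ih' with h | ⟨hng, -⟩
            · exact h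
            · exact absurd hprev hng
          have hstep' : X (K + 1 + (t + 1)) = Sop 1 (X (K + 1 + t)) := by
            rw [hstep, ratio_eq_one_of_lt_two (by omega) hg]
          have h := hb.sop_one
          rw [← hstep'] at h
          exact h.mono (by norm_num)
  intro l hl hlm
  obtain ⟨t, rfl⟩ : ∃ t, l = K + 1 + (t + 1) := ⟨l - K - 2, by omega⟩
  apply condI_of_boxed
  rcases inv (t + 1) hlm with h | ⟨-, h | ⟨h0, -⟩⟩
  · exact h.mono (by norm_num)
  · exact h.mono (by norm_num)
  · omega

/-! ## §3 Birth: the fat threshold is at most `fatWait d′`, and «K ≤ n₀ − j + R_j» -/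

/-- **THE LAST FAT INDEX IS AT MOST `fatWait d′`.**  If the cover of a non-empty face-connected `Z` of class
`d′ ≥ treeLen Z` still has tree length `≥ 1` at relative index `i₀` (inside the horizon, `L ≥ 4`, drop control),
then `i₀ ≤ fatWait d′ = max 1 ⌊log₂ d′⌋` — from `2^{i₀}·d′_{j+i₀}(Z^{(i₀)}) ≤ d′_j(Z)` for `i₀ ≥ 2`
(`B16SProfile.two_pow_mul_treeLen_closureIdx_le`). [folklore] -/
theorem threshold_le_fatWait {L : ℕ} {σ : ℕ → ℕ} {m i₀ : ℕ} (hL : 4 ≤ L) (hσ : DropCtl σ m)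
    {Z : Finset (Pt d)} (hZ : Z.Nonempty) (hZc : FaceConnected Z) {cls : ℕ} (hcls : treeLen Z ≤ cls)
    (hi₀ : i₀ ≤ m) (h1 : 1 ≤ treeLen (closureIdx (Qprod (ratio L σ) i₀) Z)) : i₀ ≤ fatWait cls := by
  unfold fatWait
  rcases Nat.lt_or_ge i₀ 2 with hlt | hge
  · exact le_max_of_le_left (by omega)
  · apply le_max_of_le_right
    have h2 := two_pow_mul_treeLen_closureIdx_le hL hσ hZ hZc hge hi₀
    have hpow : (2 : ℝ) ^ i₀ ≤ cls := by
      have : (2 : ℝ) ^ i₀ * 1 ≤ (2 : ℝ) ^ i₀ * treeLen (closureIdx (Qprod (ratio L σ) i₀) Z) :=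
        mul_le_mul_of_nonneg_left h1 (by positivity)
      linarith
    have hnat : 2 ^ i₀ ≤ cls := by exact_mod_cast hpow
    exact Nat.le_log_of_pow_le (by norm_num) hnat

/-- **«K ≤ n₀ − j + R_j» AGAINST THE CLASS**: for a non-empty face-connected region `Z` of class `d′ ≥ treeLen Z`
(`L ≥ 4`, drop control on a horizon `m ≥ fatWait d′ + N`, size parameter `Nsz ≥ 64`, memory `N ≥ 1`, the steps after
the birth clean), the stopping property holds at `i₀ + N` for the fat threshold `i₀ ≤ fatWait d′`, and condition (i)
(even with `64`) holds at every later index of the horizon. [folklore] -/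
theorem stopAt_birth {Nsz N L : ℕ} {σ : ℕ → ℕ} {m : ℕ} (hNsz : 64 ≤ Nsz) (hN : 1 ≤ N) (hL : 4 ≤ L)
    (hσ : DropCtl σ m) {Z : Finset (Pt d)} (hZ : Z.Nonempty) (hZc : FaceConnected Z) {cls : ℕ}
    (hcls : treeLen Z ≤ cls) (Clean : ℕ → Prop) (hclean : ∀ l, 1 ≤ l → l ≤ m → Clean l)
    (hm : fatWait cls + N ≤ m) :
    ∃ i₀, i₀ ≤ fatWait cls ∧ StopAt Nsz N Clean (fun i => Siter (ratio L σ) i Z) (i₀ + N) ∧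
      ∀ i, i₀ < i → i ≤ m → CondI 64 (Siter (ratio L σ) i Z) := by
  have hL3 : 3 ≤ L := by omega
  obtain ⟨i₀, hi₀m, hA, hB⟩ := exists_threshold (show 0 < L by omega) σ m hZ hZc
  have hi₀ : i₀ ≤ fatWait cls := by
    rcases Nat.eq_zero_or_pos i₀ with h0 | hpos
    · rw [h0]; exact Nat.zero_le _
    · exact threshold_le_fatWait hL hσ hZ hZc hcls hi₀m (hA i₀ hpos le_rfl)
  exact ⟨i₀, hi₀, stopAt_threshold hNsz hN hL3 hσ hZ hZc i₀ hB Clean hclean (by omega),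
    fun i hi him => condI_64_of_lt_one hL3 hσ hZ hZc him (hB i hi him)⟩

/-! ## §4 Renewal: «hence K = R_{j+1} for Z» -/

/-- **RESTART AFTER A RENEWAL.**  Along an iterate sequence of the flow (`L ≥ 3`, drop control on the horizon `m`): if
condition (i) holds at index `K` (the component is READY there and is renewed at `K + 1`), then for any memory `N′ ≥ 1`
and any cleanliness predicate holding on the scales `K + 2, …, K + 1 + N′` (no further large fields after the
renewal), the stopping property holds at `K + 1 + N′` — the renewed component is ready again `N′` steps after its
renewal step. [folklore] -/
theorem stopAt_restart {L : ℕ} (hL : 3 ≤ L) {σ : ℕ → ℕ} {m : ℕ} (hσ : DropCtl σ m) {X : ℕ → Finset (Pt d)}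
    (hX : ∀ l, X (l + 1) = Sop (ratio L σ l) (X l)) {K : ℕ} (hK : CondI 100 (X K)) {N' : ℕ} (hN' : 1 ≤ N')
    (Clean' : ℕ → Prop) (hclean : ∀ l, K + 2 ≤ l → l ≤ K + 1 + N' → Clean' l) (hm : K + 1 + N' ≤ m) :
    StopAt 100 N' Clean' X (K + 1 + N') := by
  refine ⟨by omega, condI_from_add_two hL hσ hX hK _ (by omega) hm, by omega, fun l h1 h2 => ⟨hclean l (by omega) h2, ?_⟩⟩
  exact condI_from_add_two hL hσ hX hK l (by omega) (by omega)

/-! ## §5 Join: «K ≤ K₂ + n₁ + R_{j+1}», symmetric in the partners -/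

/-- a stopping datum with memory `0` from condition (i) alone (what `B16MergeHorizon.stopAt_merge` uses of a partner)
[folklore] -/
theorem stopAt_zero_of_condI {X : ℕ → Finset (Pt d)} {K : ℕ} (hK : 0 < K) (h : CondI 100 (X K)) :
    StopAt 100 0 (fun _ => True) X K :=
  ⟨hK, h, Nat.zero_le _, fun l h1 h2 => by omega⟩

/-- **THE JOIN STOPS WITHIN `max K₁ K₂ + 13 + N`.**  Two domains at the join scale, touching (`a ∈ X`, `c ∈ Y`,
`Touch a c`), with condition (i) at own indices `K₁, K₂ ≥ 1` along the common flow (`L ≥ 2`, drop control on the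
horizon `m′`); memory `N ≥ 1`, the steps after the join clean: the union has the stopping property at some
`k ≤ max K₁ K₂ + 13 + N` (inside the horizon), and `k ≥ 1`. [folklore] -/
theorem stopAt_join {L : ℕ} (hL : 2 ≤ L) {σ : ℕ → ℕ} {m' : ℕ} (hσ : DropCtl σ m')
    {X Y : Finset (Pt d)} {a c : Pt d} (ha : a ∈ X) (hc : c ∈ Y) (hac : Touch a c)
    {K₁ K₂ : ℕ} (hK₁ : 1 ≤ K₁) (hK₂ : 1 ≤ K₂)
    (hXI : CondI 100 (Siter (ratio L σ) K₁ X)) (hYI : CondI 100 (Siter (ratio L σ) K₂ Y))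
    {N : ℕ} (hN : 1 ≤ N) (Clean : ℕ → Prop) (hclean : ∀ l, 1 ≤ l → l ≤ m' → Clean l)
    (hm : max K₁ K₂ + 13 + N ≤ m') :
    ∃ k, 1 ≤ k ∧ k ≤ max K₁ K₂ + 13 + N ∧ StopAt 100 N Clean (fun l => Siter (ratio L σ) l (X ∪ Y)) k := by
  rcases le_total K₁ K₂ with h12 | h21
  · refine ⟨max (K₂ + 6) (K₁ + 14) + N - 1, by omega, by omega, ?_⟩
    exact stopAt_merge hL hσ ha hc hac h12 (stopAt_zero_of_condI (X := fun l => Siter (ratio L σ) l X) hK₁ hXI)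
      (stopAt_zero_of_condI (X := fun l => Siter (ratio L σ) l Y) (by omega) hYI) hN Clean hclean (by omega)
  · refine ⟨max (K₁ + 6) (K₂ + 14) + N - 1, by omega, by omega, ?_⟩
    have h := stopAt_merge hL hσ hc ha hac.symm h21 (stopAt_zero_of_condI (X := fun l => Siter (ratio L σ) l Y) hK₂ hYI)
      (stopAt_zero_of_condI (X := fun l => Siter (ratio L σ) l X) (by omega) hXI) hN Clean hclean (by omega)
    simpa only [union_comm] using h

/-! ## §6 The three bounds against the booked windows `dictW` -/

/-- **BIRTH**: the physical readiness index `i₀ + R_j` of a region of class `d′` born at `j` (threshold `i₀ ≤ fatWait d′`)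
lies strictly inside the booked birth window `dictW R n₁ (j, 0, d′) = fatWait d′ + R_j + 1`. [folklore] -/
theorem birth_lt_dictW (R : ℕ → ℕ) (n₁ j : ℕ) {cls i₀ : ℕ} (hi₀ : i₀ ≤ fatWait cls) :
    i₀ + R j < dictW R n₁ (j, 0, cls) := by
  rw [dictW_birth]; omega

/-- **RENEWAL**: the physical re-readiness delay `R_s` after a renewal at step `s` lies strictly inside the booked
renewal window `dictW R n₁ (s, 1, 0) = R_s + 1`. [folklore] -/
theorem restart_lt_dictW (R : ℕ → ℕ) (n₁ s : ℕ) : R s < dictW R n₁ (s, 1, 0) := by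
  rw [dictW_renew]; omega

/-- **JOIN**: the physical readiness index `k ≤ max K₁ K₂ + 13 + R_s` of a component joined at `s` is strictly inside
the booked life `max (s + K₁ + 1) (s + K₂ + 1) + dictW R n₁ (s, 2, 0)` of the merger (window `n₁ + R_s` placed at the
later partner reach) as soon as the partners' own readiness scales `s + K₁`, `s + K₂` are strictly inside THEIR booked
reaches `r₁, r₂` and the merger allowance is `n₁ ≥ 13`. [folklore] -/
theorem join_lt_dictW (R : ℕ → ℕ) {n₁ : ℕ} (hn₁ : 13 ≤ n₁) (s : ℕ) {K₁ K₂ k r₁ r₂ : ℕ}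
    (hk : k ≤ max K₁ K₂ + 13 + R s) (h₁ : s + K₁ < r₁) (h₂ : s + K₂ < r₂) :
    s + k < max r₁ r₂ + dictW R n₁ (s, 2, 0) := by
  rw [dictW_merge]
  have := le_max_left r₁ r₂; have := le_max_right r₁ r₂
  rcases le_total K₁ K₂ with h | h
  · rw [max_eq_right h] at hk; omega
  · rw [max_eq_left h] at hk; omega

end Summit.QuantumFields.BalabanUV.T4Continuum.HistoryWindows
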